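import Mathlib.Analysis.MeanInequalities
import Literature.Analysis.FunctionSpaces.TorusTrigPoly
import Literature.Analysis.FunctionSpaces.TorusInverseLaplacianSup
import HarnessLib

/-!
# Lattice tools for the Gevrey-class estimate of Foias–Temam on `T^d`

Analysis/FluidPDE support file (theorems only; no definitions, no named facts), first of the
files proving the **Gevrey-class smoothing of classical Navier–Stokes solutions on `T³`**
(Foias–Temam, J. Funct. Anal. 87 (1989), Thm 1.1 / Lemma 2.1, periodic case) in the form used
by the tree (`TorusNSGevreyBootstrap`): a classical solution with bounded enstrophy on a time
window lies, at the end of the window, in a Gevrey class `∑ₖ e^{2σ|k|} ‖û(k)‖² ≤ C` with `σ, C`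
depending only on the viscosity, the enstrophy level, the window length and the force.

The estimate is run on the Fourier lattice `ℤ^d` with the TRUNCATED exponential weights
`e_N(ψ, k) = exp (ψ · min(|k|, N))`, `|k| = √(freqNormSq k)`, which are bounded for each `N`
(so that all weighted sums of a smooth slice are finite) and increase to `e^{ψ|k|}`. This file
supplies the elementary, PDE-free ingredients:

* `min_sqrt_freqNormSq_le_add`, `exp_mul_min_le_mul` — the **submultiplicativity**
  `e_N(ψ, k) ≤ e_N(ψ, j) e_N(ψ, k − j)` (`ψ ≥ 0`), which is what makes the Foias–Temam argument
  survive the truncation (`min(|k|,N) ≤ min(|j|,N) + min(|k−j|,N)`);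
* `sum_mul_tsum_mul_le` — the **trilinear lattice inequality**
  `∑_{k ∈ K} γ k ∑ⱼ α j β (k − j) ≤ (∑ⱼ α j) (∑ⱼ β j²)^{1/2} (∑_{k∈K} γ k²)^{1/2}`
  (Young `ℓ¹ ⋆ ℓ² ⊂ ℓ²` with Cauchy–Schwarz, for a FINITE set `K` of output frequencies);
* `tendsto_tsum_compl_freqBall_inv_freqNormSq_sq` — for `card d ≤ 3` the tails of
  `∑_{k≠0} |k|⁻⁴` over the complements of the frequency balls tend to `0`;
* `tsum_le_sqrt_card_mul_sqrt_add` — the **`ℓ¹` splitting**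
  `∑ⱼ α j ≤ (#ball ρ)^{1/2} (∑ⱼ |j|² α j²)^{1/2} + (∑_{j ∉ ball ρ} |j|⁻⁴)^{1/2} (∑ⱼ |j|⁴ α j²)^{1/2}`
  for `α ≥ 0` with `α 0 = 0`: a poor man's lattice Agmon inequality — instead of optimising `ρ`
  (lattice-point counting) the user picks `ρ` so large that the second coefficient is small,
  which suffices for a local-in-time bootstrap;
* `le_of_two_level_bound` — a discrete (topology-free) **bootstrap lemma** on an interval.

## Mathlib / tree search

Mathlib: `Real.inner_le_Lp_mul_Lq_tsum_of_nonneg`, `Real.sum_mul_le_sqrt_mul_sqrt`,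
`Summable.sum_add_tsum_compl`, `Summable.tsum_finsetSum`, `tendsto_tsum_compl_atTop_zero`; no
real discrete Young inequality (the tree's `ℝ≥0∞` ones: `EulerFourier.hnorm_zero_lconv_le_left`,
`SteadyLattice.young_one_two`). Tree: `Torus.freqBall`, `Torus.tendsto_freqBall_atTop`,
`Torus.latticeVec`, `Torus.summable_one_add_freqNormSq_rpow_neg`, and the optimised lattice
Agmon sum `Torus.tsum_agmonWeight_le` (`TorusAgmonLatticeSum`, not needed here).

Reference: C. Foias, R. Temam, *Gevrey class regularity for the solutions of the Navier–Stokes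
equations*, J. Funct. Anal. 87 (1989) 359–369, Thm 1.1, Lemma 2.1. [FoiasTemam1989]
-/

noncomputable section

open Filter Set Function Finset
open scoped Topology BigOperators

namespace Literature.Analysis.FluidPDE

namespace NSGevrey

open Literature.Analysis.FunctionSpaces Literature.Analysis.FunctionSpaces.Torus

variable {d : Type*} [Fintype d]

/-! ### Truncated exponential weights: submultiplicativity -/

section Weights

/-- `√(freqNormSq k) = ‖latticeVec k‖`: the length of a frequency is the Euclidean norm of its
lattice vector. [folklore] -/
theorem sqrt_freqNormSq_eq_norm_latticeVec [DecidableEq d] (k : d → ℤ) :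
    Real.sqrt (freqNormSq k) = ‖latticeVec k‖ := by
  rw [← Real.sqrt_sq (norm_nonneg (latticeVec k)), EuclideanSpace.norm_sq_eq, freqNormSq]
  congr 1
  refine Finset.sum_congr rfl fun i _ => ?_
  rw [latticeVec_apply, Real.norm_eq_abs, sq_abs]

/-- Triangle inequality for frequency lengths: `|j + l| ≤ |j| + |l|`. [folklore] -/
theorem sqrt_freqNormSq_add_le (j l : d → ℤ) :
    Real.sqrt (freqNormSq (j + l)) ≤ Real.sqrt (freqNormSq j) + Real.sqrt (freqNormSq l) := by
  classical
  rw [sqrt_freqNormSq_eq_norm_latticeVec, sqrt_freqNormSq_eq_norm_latticeVec,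
    sqrt_freqNormSq_eq_norm_latticeVec, latticeVec_add]
  exact norm_add_le _ _

/-- **Subadditivity of the truncated length**: `min(|k|, N) ≤ min(|j|, N) + min(|k − j|, N)` for
`N ≥ 0` — the reason the Foias–Temam submultiplicativity survives truncation of the Gevrey
weight. [folklore] -/
theorem min_sqrt_freqNormSq_le_add {N : ℝ} (hN : 0 ≤ N) (k j : d → ℤ) :
    min (Real.sqrt (freqNormSq k)) N ≤
      min (Real.sqrt (freqNormSq j)) N + min (Real.sqrt (freqNormSq (k - j))) N := by
  have htri : Real.sqrt (freqNormSq k) ≤ Real.sqrt (freqNormSq j) + Real.sqrt (freqNormSq (k - j)) := by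
    have h := sqrt_freqNormSq_add_le j (k - j)
    rwa [add_sub_cancel] at h
  have h0j : 0 ≤ Real.sqrt (freqNormSq j) := Real.sqrt_nonneg _
  have h0l : 0 ≤ Real.sqrt (freqNormSq (k - j)) := Real.sqrt_nonneg _
  rcases le_total (Real.sqrt (freqNormSq j)) N with hj | hj
  · rcases le_total (Real.sqrt (freqNormSq (k - j))) N with hl | hl
    · rw [min_eq_left hj, min_eq_left hl]
      exact (min_le_left _ _).trans htri
    · rw [min_eq_left hj, min_eq_right hl]
      exact (min_le_right _ _).trans (by linarith)
  · rw [min_eq_right hj]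
    exact (min_le_right _ _).trans (le_add_of_nonneg_right (le_min h0l hN))

/-- **Submultiplicativity of the truncated Gevrey weight**: for `ψ, N ≥ 0`,
`exp (ψ min(|k|,N)) ≤ exp (ψ min(|j|,N)) · exp (ψ min(|k−j|,N))`. [folklore] -/
theorem exp_mul_min_le_mul {ψ N : ℝ} (hψ : 0 ≤ ψ) (hN : 0 ≤ N) (k j : d → ℤ) :
    Real.exp (ψ * min (Real.sqrt (freqNormSq k)) N) ≤
      Real.exp (ψ * min (Real.sqrt (freqNormSq j)) N) *
        Real.exp (ψ * min (Real.sqrt (freqNormSq (k - j))) N) := by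
  rw [← Real.exp_add, Real.exp_le_exp, ← mul_add]
  exact mul_le_mul_of_nonneg_left (min_sqrt_freqNormSq_le_add hN k j) hψ

/-- The truncated weight is at most `exp (ψ N)` (`ψ ≥ 0`). [folklore] -/
theorem exp_mul_min_le_exp_mul {ψ N : ℝ} (hψ : 0 ≤ ψ) (k : d → ℤ) :
    Real.exp (ψ * min (Real.sqrt (freqNormSq k)) N) ≤ Real.exp (ψ * N) :=
  Real.exp_le_exp.2 (mul_le_mul_of_nonneg_left (min_le_right _ _) hψ)

/-- The truncated weight is at most the full Gevrey weight `exp (ψ |k|)` (`ψ ≥ 0`). [folklore] -/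
theorem exp_mul_min_le_exp_mul_sqrt {ψ N : ℝ} (hψ : 0 ≤ ψ) (k : d → ℤ) :
    Real.exp (ψ * min (Real.sqrt (freqNormSq k)) N) ≤ Real.exp (ψ * Real.sqrt (freqNormSq k)) :=
  Real.exp_le_exp.2 (mul_le_mul_of_nonneg_left (min_le_left _ _) hψ)

end Weights

/-! ### Cauchy–Schwarz and the trilinear lattice inequality -/

section Trilinear

/-- **Cauchy–Schwarz for real nonnegative families**: `∑' f g ≤ √(∑' f²) √(∑' g²)` when `f², g²`
are summable (Mathlib's Hölder inequality with `p = q = 2`). [folklore] -/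
theorem tsum_mul_le_sqrt_mul_sqrt_real {ι : Type*} {f g : ι → ℝ} (hf : ∀ i, 0 ≤ f i)
    (hg : ∀ i, 0 ≤ g i) (hfs : Summable fun i => f i ^ 2) (hgs : Summable fun i => g i ^ 2) :
    (Summable fun i => f i * g i) ∧
      ∑' i, f i * g i ≤ Real.sqrt (∑' i, f i ^ 2) * Real.sqrt (∑' i, g i ^ 2) := by
  have hfs' : Summable fun i => f i ^ (2 : ℝ) := by simpa only [Real.rpow_two] using hfs
  have hgs' : Summable fun i => g i ^ (2 : ℝ) := by simpa only [Real.rpow_two] using hgs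
  have h := Real.summable_and_inner_le_Lp_mul_Lq_tsum_of_nonneg Real.HolderConjugate.two_two hf hg
    hfs' hgs'
  refine ⟨h.1, ?_⟩
  have h2 := h.2
  simp only [Real.rpow_two] at h2
  rwa [Real.sqrt_eq_rpow, Real.sqrt_eq_rpow]

/-- A square-summable nonnegative family is bounded by the root of its sum of squares. [folklore] -/
theorem le_sqrt_tsum_sq {ι : Type*} {g : ι → ℝ} (hg : ∀ i, 0 ≤ g i)
    (hgs : Summable fun i => g i ^ 2) (i : ι) : g i ≤ Real.sqrt (∑' j, g j ^ 2) := by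
  rw [← Real.sqrt_sq (hg i)]
  exact Real.sqrt_le_sqrt (hgs.le_tsum i fun j _ => sq_nonneg (g j))

/-- **The trilinear lattice inequality** (Young `ℓ¹ ⋆ ℓ² ⊂ ℓ²` followed by Cauchy–Schwarz, for a
finite set `K` of output frequencies): for nonnegative families on an additive group with `α`
summable and `β` square summable,
`∑_{k ∈ K} γ k · ∑ⱼ α j β (k − j) ≤ (∑ⱼ α j) · √(∑ⱼ β j²) · √(∑_{k ∈ K} γ k²)`.
This is the shape of the Foias–Temam bound of the Gevrey-weighted trilinear form once the
weight has been distributed over the three factors. [cite: FoiasTemam1989, Lemma 2.1] -/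
theorem sum_mul_tsum_mul_le {ι : Type*} [AddCommGroup ι] (K : Finset ι) {α β γ : ι → ℝ}
    (hα : ∀ j, 0 ≤ α j) (hβ : ∀ j, 0 ≤ β j) (hγ : ∀ k, 0 ≤ γ k) (hαs : Summable α)
    (hβs : Summable fun j => β j ^ 2) :
    ∑ k ∈ K, γ k * ∑' j, α j * β (k - j) ≤
      (∑' j, α j) * Real.sqrt (∑' j, β j ^ 2) * Real.sqrt (∑ k ∈ K, γ k ^ 2) := by
  set B : ℝ := Real.sqrt (∑' j, β j ^ 2) with hB
  set C : ℝ := Real.sqrt (∑ k ∈ K, γ k ^ 2) with hC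
  have hB0 : 0 ≤ B := Real.sqrt_nonneg _
  have hC0 : 0 ≤ C := Real.sqrt_nonneg _
  have hβle : ∀ j, β j ≤ B := le_sqrt_tsum_sq hβ hβs
  -- summability of the inner families `j ↦ γ k α j β (k - j)`
  have hin0 : ∀ k, Summable fun j => α j * β (k - j) := fun k =>
    (hαs.mul_right B).of_nonneg_of_le (fun j => mul_nonneg (hα j) (hβ _)) fun j =>
      mul_le_mul_of_nonneg_left (hβle _) (hα j)
  have hin : ∀ k, Summable fun j => γ k * (α j * β (k - j)) := fun k => (hin0 k).mul_left (γ k)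
  -- exchange the finite sum with the series
  have hx : ∑ k ∈ K, γ k * ∑' j, α j * β (k - j) = ∑' j, ∑ k ∈ K, γ k * (α j * β (k - j)) := by
    rw [Summable.tsum_finsetSum fun k _ => hin k]
    exact Finset.sum_congr rfl fun k _ => ((hin0 k).tsum_mul_left (γ k)).symm
  rw [hx]
  -- Cauchy–Schwarz in the finite sum, for each fixed `j`
  have hcs : ∀ j, ∑ k ∈ K, γ k * (α j * β (k - j)) ≤ α j * (B * C) := by
    intro j
    have h1 : ∑ k ∈ K, γ k * (α j * β (k - j)) = α j * ∑ k ∈ K, β (k - j) * γ k := by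
      rw [Finset.mul_sum]
      exact Finset.sum_congr rfl fun k _ => by ring
    rw [h1]
    refine mul_le_mul_of_nonneg_left ?_ (hα j)
    have h2 := Real.sum_mul_le_sqrt_mul_sqrt K (fun k => β (k - j)) (fun k => γ k)
    refine h2.trans (mul_le_mul_of_nonneg_right ?_ hC0)
    refine Real.sqrt_le_sqrt ?_
    -- `∑_{k ∈ K} β (k - j)² ≤ ∑' l, β l²` (reindex by the translation `k ↦ k - j`)
    have h3 : ∑ k ∈ K, β (k - j) ^ 2 = ∑ l ∈ K.map (Equiv.subRight j).toEmbedding, β l ^ 2 := by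
      rw [Finset.sum_map]
      rfl
    rw [h3]
    exact hβs.sum_le_tsum _ fun l _ => sq_nonneg (β l)
  have hsum : Summable fun j => α j * (B * C) := hαs.mul_right _
  calc ∑' j, ∑ k ∈ K, γ k * (α j * β (k - j)) ≤ ∑' j, α j * (B * C) :=
        Summable.tsum_le_tsum hcs (hsum.of_nonneg_of_le (fun j => Finset.sum_nonneg fun k _ =>
          mul_nonneg (hγ k) (mul_nonneg (hα j) (hβ _))) hcs) hsum
    _ = (∑' j, α j) * B * C := by rw [tsum_mul_right, mul_assoc]

end Trilinear

/-! ### The lattice sum `∑_{k ≠ 0} |k|⁻⁴` in dimension `≤ 3` and the `ℓ¹` splitting -/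

section Split

/-- For `card d ≤ 3` the lattice sum `∑_{k ≠ 0} |k|⁻⁴` converges (majorant `4 (1 + |k|²)⁻²`,
summable since `4 > card d`; the origin is excluded by the `if`). [folklore] -/
theorem summable_ite_inv_freqNormSq_sq [Nonempty d] (hd : Fintype.card d ≤ 3) :
    Summable fun k : d → ℤ => if k = 0 then (0 : ℝ) else (freqNormSq k ^ 2)⁻¹ := by
  classical
  have hs : (Fintype.card d : ℝ) < 2 * 2 := by
    have : (Fintype.card d : ℝ) ≤ 3 := by exact_mod_cast hd
    linarith
  have hmaj := (summable_one_add_freqNormSq_rpow_neg (d := d) hs).mul_left 4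
  refine Summable.of_nonneg_of_le (fun k => ?_) (fun k => ?_) hmaj
  · split_ifs
    · exact le_rfl
    · positivity
  · have hf := freqNormSq_nonneg k
    have hrpow : (1 + freqNormSq k) ^ (-(2 : ℝ)) = ((1 + freqNormSq k) ^ 2)⁻¹ := by
      rw [Real.rpow_neg (by linarith), show (2 : ℝ) = ((2 : ℕ) : ℝ) by norm_num, Real.rpow_natCast]
    rw [hrpow]
    split_ifs with hk
    · positivity
    · have h1 : 1 ≤ freqNormSq k := one_le_freqNormSq_of_ne_zero hk
      rw [← one_div, ← div_eq_mul_inv, div_le_div_iff₀ (by positivity) (by positivity)]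
      nlinarith

/-- **The tails of `∑_{k ≠ 0} |k|⁻⁴` vanish** (`card d ≤ 3`): `∑_{k ∉ ball ρ} |k|⁻⁴ → 0` as
`ρ → ∞` (the balls exhaust the lattice, `Torus.tendsto_freqBall_atTop`; outside a ball `k ≠ 0`).
[folklore] -/
theorem tendsto_tsum_compl_freqBall_inv_freqNormSq_sq [DecidableEq d] :
    Tendsto (fun ρ : ℕ => ∑' k : {k // k ∉ freqBall (d := d) ρ}, (freqNormSq (k : d → ℤ) ^ 2)⁻¹)
      atTop (𝓝 0) := by
  have h := (tendsto_tsum_compl_atTop_zero fun k : d → ℤ =>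
    if k = 0 then (0 : ℝ) else (freqNormSq k ^ 2)⁻¹).comp tendsto_freqBall_atTop
  refine h.congr fun ρ => ?_
  simp only [Function.comp_apply]
  refine tsum_congr fun k => ?_
  have hk : (k : d → ℤ) ≠ 0 := fun h0 => k.2 (h0 ▸ zero_mem_freqBall ρ)
  rw [if_neg hk]

/-- **`ℓ¹` splitting of a lattice family at a frequency ball** (a non-optimised lattice Agmon
inequality): for `α ≥ 0` with `α 0 = 0` and `∑ |j|² α j²`, `∑ |j|⁴ α j²` summable, `card d ≤ 3`,
`∑ⱼ α j ≤ √(#ball ρ) √(∑ⱼ |j|² α j²) + √(∑_{j ∉ ball ρ} |j|⁻⁴) √(∑ⱼ |j|⁴ α j²)`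
(Cauchy–Schwarz on the ball with `α j ≤ |j| α j`, and off the ball with `α j = |j|⁻² · |j|² α j`).
Foias–Temam use the optimised version `∑ α ≤ c (∑|j|²α²)^{1/4} (∑|j|⁴α²)^{1/4}`; for a
local-in-time bootstrap it suffices to take `ρ` large. [cite: FoiasTemam1989, Lemma 2.1] -/
theorem tsum_le_sqrt_card_mul_sqrt_add [Nonempty d] [DecidableEq d] (hd : Fintype.card d ≤ 3)
    {α : (d → ℤ) → ℝ}
    (hα : ∀ j, 0 ≤ α j) (hα0 : α 0 = 0) (h2 : Summable fun j => freqNormSq j * α j ^ 2)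
    (h4 : Summable fun j => freqNormSq j ^ 2 * α j ^ 2) (ρ : ℕ) :
    Summable α ∧ ∑' j, α j ≤
      Real.sqrt ((freqBall (d := d) ρ).card) * Real.sqrt (∑' j, freqNormSq j * α j ^ 2) +
        Real.sqrt (∑' k : {k // k ∉ freqBall (d := d) ρ}, (freqNormSq (k : d → ℤ) ^ 2)⁻¹) *
          Real.sqrt (∑' j, freqNormSq j ^ 2 * α j ^ 2) := by
  -- `α j ≤ |j| α j` (as `|j| ≥ 1` off the origin and `α 0 = 0`)
  have hone : ∀ j, α j ≤ Real.sqrt (freqNormSq j) * α j := by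
    intro j
    by_cases hj : j = 0
    · rw [hj, hα0, mul_zero]
    · exact le_mul_of_one_le_left (hα j)
        (Real.one_le_sqrt.2 (one_le_freqNormSq_of_ne_zero hj))
  -- summability of `α`: Cauchy–Schwarz against `|j|⁻²`
  set w : (d → ℤ) → ℝ := fun k => if k = 0 then (0 : ℝ) else (freqNormSq k ^ 2)⁻¹ with hw
  have hws : Summable w := summable_ite_inv_freqNormSq_sq hd
  have hw0 : ∀ k, 0 ≤ w k := fun k => by
    simp only [hw]
    split_ifs
    · exact le_rfl
    · positivity
  set f : (d → ℤ) → ℝ := fun k => Real.sqrt (w k) with hf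
  set g : (d → ℤ) → ℝ := fun k => freqNormSq k * α k with hg
  have hf0 : ∀ k, 0 ≤ f k := fun k => Real.sqrt_nonneg (w k)
  have hg0 : ∀ k, 0 ≤ g k := fun k => mul_nonneg (freqNormSq_nonneg k) (hα k)
  have hf2 : ∀ k, f k ^ 2 = w k := fun k => Real.sq_sqrt (hw0 k)
  have hg2 : ∀ k, g k ^ 2 = freqNormSq k ^ 2 * α k ^ 2 := fun k => by rw [hg]; ring
  have hfs : Summable fun k => f k ^ 2 := hws.congr fun k => (hf2 k).symm
  have hgs : Summable fun k => g k ^ 2 := h4.congr fun k => (hg2 k).symm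
  have hfg : ∀ k, α k = f k * g k := by
    intro k
    by_cases hk : k = 0
    · rw [hk, hα0, hg]
      dsimp only
      rw [hα0, mul_zero, mul_zero]
    · have h1 : 1 ≤ freqNormSq k := one_le_freqNormSq_of_ne_zero hk
      rw [hf, hg, hw]
      dsimp only
      rw [if_neg hk, Real.sqrt_inv, Real.sqrt_sq (by linarith)]
      field_simp
  have hcs := tsum_mul_le_sqrt_mul_sqrt_real (f := f) (g := g) hf0 hg0 hfs hgs
  have hαs : Summable α := hcs.1.congr fun k => (hfg k).symm
  refine ⟨hαs, ?_⟩
  -- split the series at the ball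
  rw [← hαs.sum_add_tsum_compl (s := freqBall ρ)]
  refine add_le_add ?_ ?_
  · -- on the ball: `∑ α ≤ ∑ 1 · (|j| α j) ≤ √#ball √(∑ |j|² α²)`
    calc ∑ j ∈ freqBall ρ, α j ≤ ∑ j ∈ freqBall ρ, 1 * (Real.sqrt (freqNormSq j) * α j) :=
          Finset.sum_le_sum fun j _ => by rw [one_mul]; exact hone j
      _ ≤ Real.sqrt (∑ j ∈ freqBall ρ, (1 : ℝ) ^ 2) *
            Real.sqrt (∑ j ∈ freqBall ρ, (Real.sqrt (freqNormSq j) * α j) ^ 2) :=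
          Real.sum_mul_le_sqrt_mul_sqrt _ _ _
      _ ≤ Real.sqrt ((freqBall (d := d) ρ).card) * Real.sqrt (∑' j, freqNormSq j * α j ^ 2) := by
          refine mul_le_mul (le_of_eq ?_) ?_ (Real.sqrt_nonneg _) (Real.sqrt_nonneg _)
          · rw [Finset.sum_const, one_pow, nsmul_eq_mul, mul_one]
          · refine Real.sqrt_le_sqrt ?_
            have heq : ∀ j, (Real.sqrt (freqNormSq j) * α j) ^ 2 = freqNormSq j * α j ^ 2 :=
              fun j => by rw [mul_pow, Real.sq_sqrt (freqNormSq_nonneg j)]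
            simp only [heq]
            exact h2.sum_le_tsum _ fun j _ => mul_nonneg (freqNormSq_nonneg j) (sq_nonneg _)
  · -- off the ball: Cauchy–Schwarz against `|j|⁻²`
    have hf' : ∀ k : {k // k ∉ freqBall (d := d) ρ}, 0 ≤ f k := fun k => hf0 k
    have hg' : ∀ k : {k // k ∉ freqBall (d := d) ρ}, 0 ≤ g k := fun k => hg0 k
    have hfs' : Summable fun k : {k // k ∉ freqBall (d := d) ρ} => f k ^ 2 := hfs.subtype _
    have hgs' : Summable fun k : {k // k ∉ freqBall (d := d) ρ} => g k ^ 2 := hgs.subtype _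
    have hcs' := tsum_mul_le_sqrt_mul_sqrt_real (f := fun k : {k // k ∉ freqBall (d := d) ρ} => f k)
      (g := fun k : {k // k ∉ freqBall (d := d) ρ} => g k) hf' hg' hfs' hgs'
    have hlhs : ∑' k : {k // k ∉ freqBall (d := d) ρ}, α k =
        ∑' k : {k // k ∉ freqBall (d := d) ρ}, f k * g k := tsum_congr fun k => hfg k
    have hwk : ∀ k : {k // k ∉ freqBall (d := d) ρ}, f k ^ 2 = (freqNormSq (k : d → ℤ) ^ 2)⁻¹ := by
      intro k
      have hk : (k : d → ℤ) ≠ 0 := fun h0 => k.2 (h0 ▸ zero_mem_freqBall ρ)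
      rw [hf2, hw]
      dsimp only
      rw [if_neg hk]
    change ∑' k : {k // k ∉ freqBall (d := d) ρ}, α k ≤ _
    rw [hlhs]
    refine hcs'.2.trans ?_
    refine mul_le_mul (le_of_eq (congrArg Real.sqrt (tsum_congr hwk))) ?_
      (Real.sqrt_nonneg _) (Real.sqrt_nonneg _)
    refine Real.sqrt_le_sqrt ?_
    simp only [hg2]
    exact Summable.tsum_subtype_le (fun j => freqNormSq j ^ 2 * α j ^ 2) {k | k ∉ freqBall ρ}
      (fun j => mul_nonneg (sq_nonneg _) (sq_nonneg _)) h4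

end Split

/-! ### A discrete bootstrap lemma -/

section Bootstrap

/-- **Two-level bootstrap on an interval.** Let `y : ℝ → ℝ` satisfy, for all
`t₀ ≤ s ≤ t ≤ t₁`: if `y ≤ M` on `[t₀, s)` then `y t ≤ y₀ + (s − t₀) G + (t − s) G'` (`G, G' ≥ 0`;
think of an integral inequality `y(t) ≤ y₀ + ∫ g(y)` with `g(y) ≤ G` while `y ≤ M` and an
a-priori bound `g(y) ≤ G'` always). If `y₀ + (t₁ − t₀) G < M` then `y ≤ M` on `[t₀, t₁]`.
Proof: induction over time steps of length `δ` with `δ G'` below the gap — no continuity of `y`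
is needed. [folklore] -/
theorem le_of_two_level_bound {y : ℝ → ℝ} {t₀ t₁ y₀ M G G' : ℝ} (hG : 0 ≤ G) (hG' : 0 ≤ G')
    (hgap : y₀ + (t₁ - t₀) * G < M)
    (H : ∀ s t, t₀ ≤ s → s ≤ t → t ≤ t₁ → (∀ r ∈ Ico t₀ s, y r ≤ M) →
      y t ≤ y₀ + (s - t₀) * G + (t - s) * G') :
    ∀ t ∈ Icc t₀ t₁, y t ≤ M := by
  set δ : ℝ := (M - (y₀ + (t₁ - t₀) * G)) / (G' + 1) with hδ
  have hG'1 : 0 < G' + 1 := by linarith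
  have hδ0 : 0 < δ := div_pos (by linarith) hG'1
  have hδG : δ * G' ≤ M - (y₀ + (t₁ - t₀) * G) :=
    (mul_le_mul_of_nonneg_left (show G' ≤ G' + 1 by linarith) hδ0.le).trans
      (le_of_eq (by rw [hδ]; field_simp))
  -- induction over the steps `[t₀, t₀ + n δ]`
  have step : ∀ n : ℕ, ∀ t ∈ Icc t₀ t₁, t ≤ t₀ + n * δ → y t ≤ M := by
    intro n
    induction n with
    | zero =>
      intro t ht htn
      simp only [Nat.cast_zero, zero_mul, add_zero] at htn
      have hteq : t = t₀ := le_antisymm htn ht.1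
      have h := H t₀ t₀ le_rfl le_rfl (ht.1.trans ht.2) (fun r hr => absurd hr.2 (not_lt.2 hr.1))
      rw [hteq]
      have h01 : 0 ≤ (t₁ - t₀) * G := mul_nonneg (by linarith [ht.1, ht.2]) hG
      linarith
    | succ n ih =>
      intro t ht htn
      by_cases hle : t ≤ t₀ + n * δ
      · exact ih t ht hle
      · push Not at hle
        set s : ℝ := t₀ + n * δ with hs
        have hs0 : t₀ ≤ s := le_add_of_nonneg_right (mul_nonneg n.cast_nonneg hδ0.le)
        have hst : s ≤ t := hle.le
        have hpast : ∀ r ∈ Ico t₀ s, y r ≤ M := fun r hr =>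
          ih r ⟨hr.1, (hr.2.le.trans hst).trans ht.2⟩ hr.2.le
        have h := H s t hs0 hst ht.2 hpast
        have h1 : (s - t₀) * G ≤ (t₁ - t₀) * G := mul_le_mul_of_nonneg_right (by linarith [ht.2]) hG
        have h2 : (t - s) * G' ≤ δ * G' := by
          refine mul_le_mul_of_nonneg_right ?_ hG'
          have : t ≤ t₀ + (n + 1 : ℕ) * δ := htn
          push_cast at this
          linarith
        linarith
  intro t ht
  obtain ⟨n, hn⟩ := exists_nat_ge ((t₁ - t₀) / δ)
  refine step n t ht ?_
  have h1 : t₁ - t₀ ≤ n * δ := by rwa [div_le_iff₀ hδ0] at hn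
  linarith [ht.2]

end Bootstrap

end NSGevrey

end Literature.Analysis.FluidPDE
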